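import Mathlib.Probability.Moments.Variance
import Mathlib.MeasureTheory.Integral.Prod
import HarnessLib

/-!
# The law of total variance, inequality form, on a product probability space

Topic `Literature/Probability/Moments` (kind proof; no new notions).  For a bounded measurable
function `F` of two INDEPENDENT blocks of coordinates `(x, y)`, realised on the product of two
probability spaces `μ ⊗ ν`, the variance splits into the mean conditional variance (given the first
block) and the variance of the conditional mean:

  `Var_{μ⊗ν}(F) = ∫ Var_ν(F(x, ·)) dμ(x) + Var_μ(x ↦ ∫ F(x, y) dν(y))`

(law of total variance / Pythagoras in `L²`, Durrett 2019 §4.1 Ex. 4.1.7 for the conditional form).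
We prove the INEQUALITY with constants `2, 2` (`variance_prod_le`), which is all that concentration
bookkeeping consumes and avoids the orthogonality computation: pointwise
`(F − m)² ≤ 2 (F − F̄(x))² + 2 (F̄(x) − m)²`, then Fubini.  Consumers bound the first term by a
POINTWISE-in-`x` variance estimate for the second block (e.g. Efron–Stein in the `y`-coordinates) and
the second by a variance estimate for a function of the first block alone.

## Mathlib

We USE `ProbabilityTheory.variance_eq_integral`, `MeasureTheory.integral_prod`,
`MeasureTheory.integral_fun_fst`, `StronglyMeasurable.integral_prod_right'`.  Mathlib has the
conditional variance `ProbabilityTheory.condVar` and `condVar_ae_eq …` identities but no product-space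
statement of the law of total variance (searched `condVar`, `variance_prod`, `total variance`).

## References

* R. Durrett, *Probability: Theory and Examples*, 5th ed. (CUP 2019), §4.1.  [Durrett2019]
-/

noncomputable section

open MeasureTheory ProbabilityTheory

namespace Literature.Probability.Moments

variable {X Y : Type*} [MeasurableSpace X] [MeasurableSpace Y]

/-- The conditional mean `x ↦ ∫ F(x, y) dν` of a bounded jointly measurable `F` is measurable and
obeys the same bound (probability measure `ν`). [folklore] -/
theorem measurable_integral_right_and_abs_le (ν : Measure Y) [IsProbabilityMeasure ν]
    {F : X × Y → ℝ} (hF : Measurable F) {C : ℝ} (hC : ∀ p, |F p| ≤ C) :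
    (Measurable fun x => ∫ y, F (x, y) ∂ν) ∧ ∀ x, |∫ y, F (x, y) ∂ν| ≤ C := by
  refine ⟨(hF.stronglyMeasurable.integral_prod_right' (ν := ν)).measurable, fun x => ?_⟩
  have h := norm_integral_le_of_norm_le_const (μ := ν) (f := fun y => F (x, y)) (C := C)
    (ae_of_all _ fun y => by rw [Real.norm_eq_abs]; exact hC (x, y))
  rwa [probReal_univ, mul_one, Real.norm_eq_abs] at h

/-- **Law of total variance, inequality form.**  For probability measures `μ`, `ν` and a bounded
measurable `F : X × Y → ℝ`,
`Var_{μ⊗ν}(F) ≤ 2 ∫ Var_ν(F(x, ·)) dμ(x) + 2 Var_μ(x ↦ ∫ F(x, y) dν(y))`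
(pointwise `(F − m)² ≤ 2(F − F̄(x))² + 2(F̄(x) − m)²` with `F̄` the conditional mean and `m` the
mean, which is also the `μ`-mean of `F̄`; then Fubini). [folklore] -/
theorem variance_prod_le (μ : Measure X) (ν : Measure Y) [IsProbabilityMeasure μ]
    [IsProbabilityMeasure ν] {F : X × Y → ℝ} (hF : Measurable F) {C : ℝ} (hC : ∀ p, |F p| ≤ C) :
    variance F (μ.prod ν) ≤
      2 * ∫ x, variance (fun y => F (x, y)) ν ∂μ +
        2 * variance (fun x => ∫ y, F (x, y) ∂ν) μ := by
  obtain ⟨hFbm, hFbb⟩ := measurable_integral_right_and_abs_le ν hF hC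
  set Fb : X → ℝ := fun x => ∫ y, F (x, y) ∂ν with hFb
  set m : ℝ := ∫ p, F p ∂(μ.prod ν) with hm
  have hFint : Integrable F (μ.prod ν) :=
    Integrable.of_bound hF.aestronglyMeasurable C
      (ae_of_all _ fun p => by rw [Real.norm_eq_abs]; exact hC p)
  have hm' : m = ∫ x, Fb x ∂μ := integral_prod F hFint
  have hmC : |m| ≤ C := by
    have h := norm_integral_le_of_norm_le_const (μ := μ.prod ν) (f := F) (C := C)
      (ae_of_all _ fun p => by rw [Real.norm_eq_abs]; exact hC p)
    rwa [probReal_univ, mul_one, Real.norm_eq_abs] at h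
  -- the two pieces
  set G₁ : X × Y → ℝ := fun p => (F p - Fb p.1) ^ 2 with hG₁
  set G₂ : X × Y → ℝ := fun p => (Fb p.1 - m) ^ 2 with hG₂
  have hG₁m : Measurable G₁ := (hF.sub (hFbm.comp measurable_fst)).pow_const 2
  have hG₂m : Measurable G₂ := ((hFbm.comp measurable_fst).sub measurable_const).pow_const 2
  have hsq : ∀ {a b : ℝ}, |a| ≤ C → |b| ≤ C → |(a - b) ^ 2| ≤ (2 * C) ^ 2 := by
    intro a b ha hb
    rw [abs_pow, ← sq_abs, abs_abs]
    refine pow_le_pow_left₀ (abs_nonneg _) ?_ 2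
    calc |a - b| ≤ |a| + |b| := abs_sub _ _
      _ ≤ C + C := add_le_add ha hb
      _ = 2 * C := by ring
  have hG₁int : Integrable G₁ (μ.prod ν) :=
    Integrable.of_bound hG₁m.aestronglyMeasurable ((2 * C) ^ 2)
      (ae_of_all _ fun p => by rw [Real.norm_eq_abs]; exact hsq (hC p) (hFbb p.1))
  have hG₂int : Integrable G₂ (μ.prod ν) :=
    Integrable.of_bound hG₂m.aestronglyMeasurable ((2 * C) ^ 2)
      (ae_of_all _ fun p => by rw [Real.norm_eq_abs]; exact hsq (hFbb p.1) hmC)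
  -- pointwise split
  have hpt : ∀ p : X × Y, (F p - m) ^ 2 ≤ 2 * G₁ p + 2 * G₂ p := fun p => by
    simp only [hG₁, hG₂]
    nlinarith [sq_nonneg (F p - Fb p.1 - (Fb p.1 - m))]
  -- the first piece is the mean conditional variance
  have h1 : ∫ p, G₁ p ∂(μ.prod ν) = ∫ x, variance (fun y => F (x, y)) ν ∂μ := by
    rw [integral_prod G₁ hG₁int]
    refine integral_congr_ae (ae_of_all _ fun x => ?_)
    simp only [hG₁]
    have hmeas : Measurable fun y => F (x, y) := hF.comp measurable_prodMk_left
    rw [variance_eq_integral hmeas.aemeasurable]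
  -- the second piece is the variance of the conditional mean
  have h2 : ∫ p, G₂ p ∂(μ.prod ν) = variance Fb μ := by
    simp only [hG₂]
    rw [integral_fun_fst (fun x => (Fb x - m) ^ 2), probReal_univ, one_smul,
      variance_eq_integral hFbm.aemeasurable, ← hm']
  rw [variance_eq_integral hF.aemeasurable]
  calc ∫ p, (F p - ∫ q, F q ∂(μ.prod ν)) ^ 2 ∂(μ.prod ν)
      ≤ ∫ p, 2 * G₁ p + 2 * G₂ p ∂(μ.prod ν) :=
        integral_mono_of_nonneg (ae_of_all _ fun p => sq_nonneg _)
          ((hG₁int.const_mul 2).add (hG₂int.const_mul 2)) (ae_of_all _ hpt)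
    _ = 2 * ∫ x, variance (fun y => F (x, y)) ν ∂μ + 2 * variance Fb μ := by
        rw [integral_add (hG₁int.const_mul 2) (hG₂int.const_mul 2), integral_const_mul,
          integral_const_mul, h1, h2]

end Literature.Probability.Moments

end
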